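import Literature.Analysis.FluidPDE.FluidComputer.Forgetting
import HarnessLib

/-!
# Fluid computer blueprint — the SWEEPING CHECK: what `shadow` is quantified over, typed and priced

HONEST FRAMING: low prior, high value-of-information experiment on Tao's machine paradigm; NOT a
claim that NS blows up. Nothing here constructs a design; these are further constraints every
inhabitant of `ShadowedCircuit S O s` (if any) must satisfy. They execute the "cheapest falsifier"
named in the blueprint's `ASSEMBLY.md` §2g.6 (a SWEEPING NO-GO) as far as typing allows, and they
come out as a PRICE, not as a no-go: the statics fix exactly which states the idea-bound axiom
`shadow` must tolerate at the next generation, and the dictionary turns that class into one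
inequality on the design's junk thresholds.

* **§1 Admitted debris (`Spent`, `Spent_subset_In_succ`, `ray_mem_In_succ`).** A SPENT state of
  generation `n` — read in `Aout`, junk below the RUNNING threshold `jrun √E_n` — is, by `handoff`,
  a loaded core state of generation `n+1`, hence a generation-`(n+1)` input. In particular every
  generation-`n` output design state PLUS any perturbation the generation-`n` readout does not see,
  of `X^s_{λ_n}`-size up to `jrun √E_n = (jrun/√η) √E_{n+1}` (`jrun_sqrt_Emin`), is a state on
  which `shadow` and `leak` are demanded at generation `n+1` — a relative amplitude `jrun/√η > jin`,
  i.e. MORE invisible junk than the generation's own loading tolerance.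
* **§2 Readout autonomy (`readout_autonomous`, `debris_invisible`).** `shadow` says the readout of
  a true Navier–Stokes trajectory follows the circuit orbit OF ITS OWN INITIAL READOUT within `δsh`;
  so two admitted trajectory states with the same readout have readouts within `2 δsh` of each
  other one rescaled time `σ ≤ τc` later, whatever else the states contain. Combined with §1: the
  generation-`(n+1)` readout, evaluated along true trajectories, is `2 δsh`-INSENSITIVE to adding
  to an output design state any `n`- and `(n+1)`-invisible perturbation of `X^s_{λ_n}`-size
  `≤ jrun √E_n` — one Galilean-like coarse shear of that size against a proposed concrete readout is
  the blueprint's cheapest check (ASSEMBLY §4), now with its AMPLITUDE typed.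
* **§3 Admitted amplitude grows with age (`admitted_amplitude_step`, `_growth`).** If the junk
  weights `c m` of one readout-null direction obey the per-generation bound of `forgetting_ratio`
  (`c (m+1) ≤ c m · (jcore/jrun) · √η`), the admitted ABSOLUTE amplitude `jin √E_m / c m` of that
  direction grows by at least the factor `jrun / jcore > 1` per generation of age: the class carries
  ancestors' debris amplified geometrically relative to what physics leaves behind.
* **§4 The kinematic window (`CascadeSpecs.kinematicRatio`, `admittedSweepingLoad`).** Dictionary
  (informal, ASSEMBLY §2g.8): an admitted block of age `j` (scale `λ_{n-j}`, amplitude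
  `θ₁ g^{j-1}`, `g ≥ jrun/jcore`) displaces the generation-`n` machine during its tick by
  `c₀ · (θ₁/√E_{n-j+1}) · 2^{-3/2} · (g/√(8η))^{j-1}` machine-lengths (`c₀` = turnovers per tick).
  The per-age ratio `kinematicRatio g = g/√(8η)` is `< 1` iff `g < √(8η) = 2^{α_eff - 1}`
  (`kinematicRatio_lt_one_iff`, `sqrt_eight_mul_eq_two_rpow`); then the ages sum to
  `admittedSweepingLoad g = √η/(√(8η) - g)` (`admittedSweepingLoad_hasSum`), else the partial sums
  are unbounded (`tendsto_kinematicRatio_pow_atTop`). At `g = 1` this is the ratio of the physical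
  sweeping load `sweepingLoad` of `Forgetting.lean`. The window `1 < jrun/jcore < √(8η)` for
  position-tied readouts is non-empty iff `η > 1/8` and contains `2` iff `η ≥ 1/2`
  (`two_le_sqrt_eight_mul_iff`) — the viscosity threshold once more. NO soft no-go follows; the
  idea-bound axiom `shadow` is priced, per tick and uniformly in `n`, by
  `c₀ · (jin/c₁) · admittedSweepingLoad (jrun/jcore)` machine-lengths against `δsh`.
[cite: Tao2016AveragedNS, §1.3 pp. 10–11 (obstruction (i): energy left behind at coarse scales
interacting with the fine-scale dynamics)]
-/

noncomputable section

open MeasureTheory Set Filter Topology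
open scoped ENNReal NNReal

namespace Literature.Analysis.FluidPDE.FluidComputer

open Literature.Analysis.FluidPDE.Tao2016

namespace ShadowedCircuit

variable {S : CascadeSpecs} {O : Type*} [PseudoMetricSpace O] {s : ℝ} (A : ShadowedCircuit S O s)

/-! ### §1. Spent states are next-generation inputs: the admitted debris -/

/-- The generation-`n` **spent class**: states read in the output region `Aout` at generation `n`
whose generation-`n` junk is below the RUNNING threshold `jrun √E_n` (where `leak` leaves a fired
trajectory). [cite: Tao2016AveragedNS, §1.3 pp. 10–11] -/
def Spent (n : ℕ) : Set L2C :=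
  {v | A.read n v ∈ A.Aout ∧ A.junk n v ≤ ENNReal.ofReal (A.jrun * Real.sqrt (S.Emin n))}

/-- Membership in the spent class, unfolded. [folklore] -/
theorem mem_Spent {n : ℕ} {v : L2C} :
    v ∈ A.Spent n ↔
      A.read n v ∈ A.Aout ∧ A.junk n v ≤ ENNReal.ofReal (A.jrun * Real.sqrt (S.Emin n)) :=
  Iff.rfl

/-- `handoff`, as an inclusion: every spent state of generation `n` is an output state
(read in the loaded core at generation `n+1`, with core junk there). [cite: Tao2016AveragedNS, §1.3 pp. 10–11] -/
theorem Spent_subset_Out (n : ℕ) : A.Spent n ⊆ A.Out n :=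
  fun v hv => A.handoff n v hv.1 hv.2

/-- **Admitted debris.** Every spent state of generation `n` is a generation-`(n+1)` INPUT state:
the class over which `shadow` / `leak` are quantified at generation `n+1` contains everything the
generation-`n` junk admits below its running threshold, whatever the generation-`n` readout does
not see. [cite: Tao2016AveragedNS, §1.3 pp. 10–11] -/
theorem Spent_subset_In_succ (n : ℕ) : A.Spent n ⊆ A.In (n + 1) :=
  (A.Spent_subset_Out n).trans (A.Out_subset_In n)

/-- The exit state produced by `fires` is spent (this is how `fires` was proved); recorded as the
statement that a fired trajectory re-enters the cascade through `Spent n ⊆ In (n+1)`. [folklore] -/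
theorem mem_Spent_of_read_junk {n : ℕ} {v : L2C} (hr : A.read n v ∈ A.Aout)
    (hj : A.junk n v ≤ ENNReal.ofReal (A.jrun * Real.sqrt (S.Emin n))) : v ∈ A.Spent n :=
  ⟨hr, hj⟩

/-- **Output rays are admitted next.** Let `γ θ`, `θ ≥ 0`, be a family of states all read as the
same output point `p ∈ Aout` at generation `n` (a direction the generation-`n` readout does not
see), with generation-`n` junk `≤ c θ`. Then every member of amplitude `c θ ≤ jrun √E_n` is spent,
hence a generation-`(n+1)` input state. [folklore] -/
theorem ray_mem_Spent (n : ℕ) {p : O} (hp : p ∈ A.Aout) (γ : ℝ → L2C) {c : ℝ}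
    (hread : ∀ θ : ℝ, 0 ≤ θ → A.read n (γ θ) = p)
    (hjunk : ∀ θ : ℝ, 0 ≤ θ → A.junk n (γ θ) ≤ ENNReal.ofReal (c * θ))
    {θ : ℝ} (hθ0 : 0 ≤ θ) (hθ : c * θ ≤ A.jrun * Real.sqrt (S.Emin n)) : γ θ ∈ A.Spent n := by
  refine ⟨?_, (hjunk θ hθ0).trans (ENNReal.ofReal_le_ofReal hθ)⟩
  rw [hread θ hθ0]; exact hp

/-- Output rays are generation-`(n+1)` inputs up to amplitude `c θ ≤ jrun √E_n`. [folklore] -/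
theorem ray_mem_In_succ (n : ℕ) {p : O} (hp : p ∈ A.Aout) (γ : ℝ → L2C) {c : ℝ}
    (hread : ∀ θ : ℝ, 0 ≤ θ → A.read n (γ θ) = p)
    (hjunk : ∀ θ : ℝ, 0 ≤ θ → A.junk n (γ θ) ≤ ENNReal.ofReal (c * θ))
    {θ : ℝ} (hθ0 : 0 ≤ θ) (hθ : c * θ ≤ A.jrun * Real.sqrt (S.Emin n)) : γ θ ∈ A.In (n + 1) :=
  A.Spent_subset_In_succ n (A.ray_mem_Spent n hp γ hread hjunk hθ0 hθ)

/-- The admitted amplitude in the NEXT generation's units: `jrun √E_n = (jrun/√η) √E_{n+1}` — a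
relative size `jrun/√η ≥ jrun ≥ jin` (F1) of invisible junk, more than the generation's own
loading tolerance. [folklore] -/
theorem jrun_sqrt_Emin (n : ℕ) :
    A.jrun * Real.sqrt (S.Emin n) = A.jrun / Real.sqrt S.eta * Real.sqrt (S.Emin (n + 1)) := by
  have hη : 0 < Real.sqrt S.eta := Real.sqrt_pos.2 S.eta_pos
  rw [S.Emin_succ, Real.sqrt_mul S.eta_pos.le]
  field_simp

/-- `jrun ≤ jrun/√η` for `jrun ≥ 0` (`η ≤ 1`). [folklore] -/
theorem jrun_le_jrun_div_sqrt_eta (hjrun : 0 ≤ A.jrun) : A.jrun ≤ A.jrun / Real.sqrt S.eta := by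
  have hη : 0 < Real.sqrt S.eta := Real.sqrt_pos.2 S.eta_pos
  have hη1 : Real.sqrt S.eta ≤ 1 := Real.sqrt_le_one.mpr S.eta_le_one
  rw [le_div_iff₀ hη]
  exact mul_le_of_le_one_right hjrun hη1

/-- **Exact erasure is total forgetting.** If `jcore = 0`, the generation-`(n+1)` junk VANISHES
on every spent state of generation `n` — in particular on every admitted output ray up to amplitude
`jrun √E_n` (`ray_mem_Spent`): the next junk functional cannot weigh any direction the current
readout ignores, and by induction on age no generation ever charges for ancestors' debris. [folklore] -/
theorem junk_succ_eq_zero_of_jcore_eq_zero (hjcore : A.jcore = 0) {n : ℕ} {v : L2C}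
    (hv : v ∈ A.Spent n) : A.junk (n + 1) v = 0 := by
  have h := (A.handoff n v hv.1 hv.2).2
  rw [hjcore, zero_mul, ENNReal.ofReal_zero] at h
  exact le_antisymm h bot_le

/-! ### §2. Readout autonomy: what `shadow` asserts across the admitted class -/

/-- **Readout autonomy.** Two mild Navier–Stokes trajectory states loaded at generation `n` with
the SAME readout have, one rescaled time `σ ≤ τc` later (while both trajectories are alive),
readouts within `2 δsh` of each other — whatever else the two states contain: `shadow` ties each to
the circuit orbit of the common initial readout. [cite: Tao2016AveragedNS, §1.3 pp. 10–11] -/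
theorem readout_autonomous (n : ℕ) {a₁ a₂ : L2C} {S₁ S₂ : ℝ} {u₁ u₂ : ℝ → L2C}
    (hu₁ : IsMildSolutionFor eulerForm a₁ (Ico 0 S₁) u₁)
    (hu₂ : IsMildSolutionFor eulerForm a₂ (Ico 0 S₂) u₂) {t₁ t₂ : ℝ} (ht₁ : 0 ≤ t₁) (ht₂ : 0 ≤ t₂)
    (h₁ : u₁ t₁ ∈ A.In n) (h₂ : u₂ t₂ ∈ A.In n) (hsame : A.read n (u₁ t₁) = A.read n (u₂ t₂))
    {σ : ℝ} (hσ0 : 0 ≤ σ) (hσ : σ ≤ A.τc) (hS₁ : t₁ + A.unit n * σ < S₁)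
    (hS₂ : t₂ + A.unit n * σ < S₂) :
    dist (A.read n (u₁ (t₁ + A.unit n * σ))) (A.read n (u₂ (t₂ + A.unit n * σ))) ≤ 2 * A.δsh := by
  have hs₁ := A.shadow n a₁ S₁ u₁ hu₁ t₁ ht₁ h₁.1 h₁.2 σ hσ0 hσ hS₁
  have hs₂ := A.shadow n a₂ S₂ u₂ hu₂ t₂ ht₂ h₂.1 h₂.2 σ hσ0 hσ hS₂
  rw [hsame] at hs₁
  calc dist (A.read n (u₁ (t₁ + A.unit n * σ))) (A.read n (u₂ (t₂ + A.unit n * σ)))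
      ≤ dist (A.read n (u₁ (t₁ + A.unit n * σ))) (A.Φ σ (A.read n (u₂ t₂))) +
          dist (A.read n (u₂ (t₂ + A.unit n * σ))) (A.Φ σ (A.read n (u₂ t₂))) :=
        dist_triangle_right _ _ _
    _ ≤ A.δsh + A.δsh := add_le_add hs₁ hs₂
    _ = 2 * A.δsh := by ring

/-- **Invisible debris (the typed form of the blueprint's cheapest check).** Let `γ` be an output
ray at generation `n` as in `ray_mem_In_succ` which the generation-`(n+1)` readout does not see
either (`read (n+1) (γ θ) = read (n+1) (γ 0)`). Then for any two admitted amplitudes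
`c θ, c θ' ≤ jrun √E_n` and any two mild trajectories passing through `γ θ`, `γ θ'` at times
`t, t' ≥ 0`, the generation-`(n+1)` readouts one rescaled time `σ ≤ τc` later differ by at most
`2 δsh`: the gate's readout must not notice the debris. [cite: Tao2016AveragedNS, §1.3 pp. 10–11] -/
theorem debris_invisible (n : ℕ) {p : O} (hp : p ∈ A.Aout) (γ : ℝ → L2C) {c : ℝ}
    (hread : ∀ θ : ℝ, 0 ≤ θ → A.read n (γ θ) = p)
    (hnull : ∀ θ : ℝ, 0 ≤ θ → A.read (n + 1) (γ θ) = A.read (n + 1) (γ 0))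
    (hjunk : ∀ θ : ℝ, 0 ≤ θ → A.junk n (γ θ) ≤ ENNReal.ofReal (c * θ))
    {θ θ' : ℝ} (hθ0 : 0 ≤ θ) (hθ : c * θ ≤ A.jrun * Real.sqrt (S.Emin n)) (hθ'0 : 0 ≤ θ')
    (hθ' : c * θ' ≤ A.jrun * Real.sqrt (S.Emin n))
    {a a' : L2C} {S₁ S₂ : ℝ} {u u' : ℝ → L2C} (hu : IsMildSolutionFor eulerForm a (Ico 0 S₁) u)
    (hu' : IsMildSolutionFor eulerForm a' (Ico 0 S₂) u') {t t' : ℝ} (ht : 0 ≤ t) (ht' : 0 ≤ t')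
    (hut : u t = γ θ) (hut' : u' t' = γ θ')
    {σ : ℝ} (hσ0 : 0 ≤ σ) (hσ : σ ≤ A.τc) (hS₁ : t + A.unit (n + 1) * σ < S₁)
    (hS₂ : t' + A.unit (n + 1) * σ < S₂) :
    dist (A.read (n + 1) (u (t + A.unit (n + 1) * σ)))
        (A.read (n + 1) (u' (t' + A.unit (n + 1) * σ))) ≤ 2 * A.δsh := by
  have h₁ : u t ∈ A.In (n + 1) := by
    rw [hut]; exact A.ray_mem_In_succ n hp γ hread hjunk hθ0 hθ
  have h₂ : u' t' ∈ A.In (n + 1) := by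
    rw [hut']; exact A.ray_mem_In_succ n hp γ hread hjunk hθ'0 hθ'
  have hsame : A.read (n + 1) (u t) = A.read (n + 1) (u' t') := by
    rw [hut, hut', hnull θ hθ0, hnull θ' hθ'0]
  exact A.readout_autonomous (n + 1) hu hu' ht ht' h₁ h₂ hsame hσ0 hσ hS₁ hS₂

/-! ### §3. The admitted amplitude of a null direction grows with its age -/

/-- **One generation of age.** If the junk weights `c m > 0` of a fixed readout-null direction
satisfy the forgetting bound `c (m+1) ≤ c m · (jcore/jrun) · √η` (the conclusion of
`forgetting_ratio`), then the admitted absolute amplitude `jin √E_m / c m` of that direction grows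
by at least `jrun/jcore` from generation `m` to `m+1`. [folklore] -/
theorem admitted_amplitude_step {c : ℕ → ℝ} (hc : ∀ m, 0 < c m) (hjcore : 0 < A.jcore)
    (hjrun : 0 < A.jrun) (hforget : ∀ m, c (m + 1) ≤ c m * (A.jcore / A.jrun) * Real.sqrt S.eta)
    (m : ℕ) :
    A.jrun / A.jcore * (A.jin * Real.sqrt (S.Emin m) / c m) ≤
      A.jin * Real.sqrt (S.Emin (m + 1)) / c (m + 1) := by
  have hη : 0 < Real.sqrt S.eta := Real.sqrt_pos.2 S.eta_pos
  have hE : 0 < Real.sqrt (S.Emin m) := Real.sqrt_pos.2 (S.Emin_pos m)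
  have hs : Real.sqrt (S.Emin (m + 1)) = Real.sqrt S.eta * Real.sqrt (S.Emin m) := by
    rw [S.Emin_succ, Real.sqrt_mul S.eta_pos.le]
  rw [hs, le_div_iff₀ (hc (m + 1))]
  have hjin : 0 ≤ A.jin := A.jin_pos.le
  have hcm : c m ≠ 0 := (hc m).ne'
  have hjr : A.jrun ≠ 0 := hjrun.ne'
  have hjc : A.jcore ≠ 0 := hjcore.ne'
  -- `(jrun/jcore)·(jin √E_m / c m) · c (m+1) ≤ (jrun/jcore)·(jin √E_m / c m)·(c m (jcore/jrun) √η) = jin √η √E_m`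
  calc A.jrun / A.jcore * (A.jin * Real.sqrt (S.Emin m) / c m) * c (m + 1)
      ≤ A.jrun / A.jcore * (A.jin * Real.sqrt (S.Emin m) / c m) *
          (c m * (A.jcore / A.jrun) * Real.sqrt S.eta) := by
        refine mul_le_mul_of_nonneg_left (hforget m) ?_
        exact mul_nonneg (div_pos hjrun hjcore).le
          (div_nonneg (mul_nonneg hjin hE.le) (hc m).le)
    _ = A.jin * (Real.sqrt S.eta * Real.sqrt (S.Emin m)) := by
        field_simp
    _ ≤ A.jin * (Real.sqrt S.eta * Real.sqrt (S.Emin m)) := le_rfl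

/-- **Geometric growth with age.** Under the same per-generation forgetting bound, after `k`
generations the admitted absolute amplitude has grown by at least `(jrun/jcore)^k`: the class on
which `shadow` is demanded carries every ancestor's invisible debris amplified geometrically with
its age (physical debris has FIXED absolute amplitude `√((1-η) E_birth)`). [folklore] -/
theorem admitted_amplitude_growth {c : ℕ → ℝ} (hc : ∀ m, 0 < c m) (hjcore : 0 < A.jcore)
    (hjrun : 0 < A.jrun) (hforget : ∀ m, c (m + 1) ≤ c m * (A.jcore / A.jrun) * Real.sqrt S.eta)
    (m k : ℕ) :
    (A.jrun / A.jcore) ^ k * (A.jin * Real.sqrt (S.Emin m) / c m) ≤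
      A.jin * Real.sqrt (S.Emin (m + k)) / c (m + k) := by
  induction k with
  | zero => simp
  | succ k ih =>
    have hg : 0 ≤ A.jrun / A.jcore := (div_pos hjrun hjcore).le
    calc (A.jrun / A.jcore) ^ (k + 1) * (A.jin * Real.sqrt (S.Emin m) / c m)
        = A.jrun / A.jcore * ((A.jrun / A.jcore) ^ k * (A.jin * Real.sqrt (S.Emin m) / c m)) := by
          rw [pow_succ]; ring
      _ ≤ A.jrun / A.jcore * (A.jin * Real.sqrt (S.Emin (m + k)) / c (m + k)) :=
          mul_le_mul_of_nonneg_left ih hg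
      _ ≤ A.jin * Real.sqrt (S.Emin (m + k + 1)) / c (m + k + 1) :=
          A.admitted_amplitude_step hc hjcore hjrun hforget (m + k)
      _ = A.jin * Real.sqrt (S.Emin (m + (k + 1))) / c (m + (k + 1)) := by rw [Nat.add_assoc]

/-- The growth factor exceeds one: `1 < jrun/jcore` whenever `jin ≤ jrun` (F1) and `jcore > 0`. [folklore] -/
theorem one_lt_jrun_div_jcore (hjcore : 0 < A.jcore) (hjin : A.jin ≤ A.jrun) :
    1 < A.jrun / A.jcore := by
  rw [lt_div_iff₀ hjcore, one_mul]
  exact A.jcore_lt.trans_le hjin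

end ShadowedCircuit

/-! ### §4. The kinematic window (spec-sheet arithmetic; the dictionary is in the docstrings) -/

namespace CascadeSpecs

variable (S : CascadeSpecs)

/-- The **kinematic ratio** per generation of age for admitted-amplitude growth `g` (`g = 1`:
physical debris; `g ≥ jrun/jcore`: what the statics admit): `g/√(8η)` — velocity of a block one
generation older is down by `2^{-3/2}` (coarser) and up by `η^{-1/2}` (born with more energy) and
by `g` (admitted amplification). [folklore] -/
def kinematicRatio (g : ℝ) : ℝ := g / Real.sqrt (8 * S.eta)

/-- `√(8η) > 0`. [folklore] -/
theorem sqrt_eight_mul_pos : 0 < Real.sqrt (8 * S.eta) :=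
  Real.sqrt_pos.2 (by linarith [S.eta_pos])

/-- `√(8η) = √8 · √η`. [folklore] -/
theorem sqrt_eight_mul_eq : Real.sqrt (8 * S.eta) = Real.sqrt 8 * Real.sqrt S.eta :=
  Real.sqrt_mul (by norm_num) S.eta

/-- At `g = 1` the kinematic ratio is the ratio `(√(8η))⁻¹` of the physical sweeping series
(`sweepingLoad_hasSum`). [folklore] -/
theorem kinematicRatio_one : S.kinematicRatio 1 = (Real.sqrt (8 * S.eta))⁻¹ := by
  simp [kinematicRatio]

/-- The kinematic ratio is nonnegative for `g ≥ 0`. [folklore] -/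
theorem kinematicRatio_nonneg {g : ℝ} (hg : 0 ≤ g) : 0 ≤ S.kinematicRatio g :=
  div_nonneg hg S.sqrt_eight_mul_pos.le

/-- **The window.** `kinematicRatio g < 1 ↔ g < √(8η)`. [folklore] -/
theorem kinematicRatio_lt_one_iff (g : ℝ) : S.kinematicRatio g < 1 ↔ g < Real.sqrt (8 * S.eta) := by
  unfold kinematicRatio
  rw [div_lt_one S.sqrt_eight_mul_pos]

/-- `1 ≤ kinematicRatio g ↔ √(8η) ≤ g`. [folklore] -/
theorem one_le_kinematicRatio_iff (g : ℝ) : 1 ≤ S.kinematicRatio g ↔ Real.sqrt (8 * S.eta) ≤ g := by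
  unfold kinematicRatio
  rw [one_le_div S.sqrt_eight_mul_pos]

/-- **In the exponent language**: `√(8η) = 2^{α_eff - 1}` — the window's edge is the
closure's kinematic decoupling factor `2^{α-1}` per generation (`U_n T_n λ_n` constant). [folklore] -/
theorem sqrt_eight_mul_eq_two_rpow : Real.sqrt (8 * S.eta) = (2 : ℝ) ^ (S.alphaEff - 1) := by
  have h2 : (2 : ℝ) ^ Real.logb 2 S.eta = S.eta := Real.rpow_logb two_pos (by norm_num) S.eta_pos
  have hexp : S.alphaEff - 1 = (3 / 2 : ℝ) + Real.logb 2 S.eta * (1 / 2 : ℝ) := by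
    unfold alphaEff; ring
  rw [hexp, Real.rpow_add two_pos, Real.rpow_mul zero_le_two, h2, S.sqrt_eight_mul_eq,
    Real.sqrt_eq_rpow, Real.sqrt_eq_rpow]
  congr 1
  rw [show (8 : ℝ) = 2 ^ (3 : ℝ) by norm_num, ← Real.rpow_mul zero_le_two]
  norm_num

/-- The window `(1, √(8η))` for `g = jrun/jcore > 1` is non-empty iff `η > 1/8`
(`one_lt_sqrt_eight_mul`); it contains `g = 2` iff `η ≥ 1/2` — the viscosity threshold
(`two_le_alphaEff_iff`) once more. [folklore] -/
theorem two_le_sqrt_eight_mul_iff : 2 ≤ Real.sqrt (8 * S.eta) ↔ 1 / 2 ≤ S.eta := by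
  rw [show (2 : ℝ) = Real.sqrt 4 by rw [show (4 : ℝ) = 2 ^ 2 by norm_num, Real.sqrt_sq zero_le_two],
    Real.sqrt_le_sqrt_iff (by linarith [S.eta_pos])]
  constructor <;> intro h <;> linarith

/-- Inside the window the age series converges (geometric). [folklore] -/
theorem summable_kinematicRatio_pow {g : ℝ} (hg0 : 0 ≤ g) (hg : g < Real.sqrt (8 * S.eta)) :
    Summable (fun j : ℕ => S.kinematicRatio g ^ j) :=
  summable_geometric_of_lt_one (S.kinematicRatio_nonneg hg0) ((S.kinematicRatio_lt_one_iff g).2 hg)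

/-- Outside the window (`g > √(8η)`) the age terms themselves blow up: arbitrarily old admitted
debris sweeps the machine by unbounded amounts — position-tied readouts with a fixed `δsh` are then
impossible. [folklore] -/
theorem tendsto_kinematicRatio_pow_atTop {g : ℝ} (hg : Real.sqrt (8 * S.eta) < g) :
    Tendsto (fun j : ℕ => S.kinematicRatio g ^ j) atTop atTop :=
  tendsto_pow_atTop_atTop_of_one_lt ((one_lt_div S.sqrt_eight_mul_pos).2 hg)

/-- The **admitted sweeping load** `√η/(√(8η) - g)`: the sum over ages `j ≥ 1` of
`2^{-3/2} (g/√(8η))^{j-1}` — displacement of a generation by all admitted ancestors' debris over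
one tick, in machine-lengths per unit `c₀ · θ₁/√E` (ASSEMBLY §2g.8). [folklore] -/
def admittedSweepingLoad (g : ℝ) : ℝ := Real.sqrt S.eta / (Real.sqrt (8 * S.eta) - g)

/-- Inside the window, `admittedSweepingLoad g` IS the age series
`Σ_{i ≥ 0} (√8)⁻¹ (g/√(8η))^i`. [folklore] -/
theorem admittedSweepingLoad_hasSum {g : ℝ} (hg0 : 0 ≤ g) (hg : g < Real.sqrt (8 * S.eta)) :
    HasSum (fun i : ℕ => (Real.sqrt 8)⁻¹ * S.kinematicRatio g ^ i) (S.admittedSweepingLoad g) := by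
  have hq0 : 0 ≤ S.kinematicRatio g := S.kinematicRatio_nonneg hg0
  have hq1 : S.kinematicRatio g < 1 := (S.kinematicRatio_lt_one_iff g).2 hg
  have hgeo := (hasSum_geometric_of_lt_one hq0 hq1).mul_left (Real.sqrt 8)⁻¹
  have h8 : (Real.sqrt 8) ≠ 0 := (Real.sqrt_pos.2 (by norm_num : (0:ℝ) < 8)).ne'
  have hη : Real.sqrt S.eta ≠ 0 := (Real.sqrt_pos.2 S.eta_pos).ne'
  have hden : Real.sqrt 8 * Real.sqrt S.eta - g ≠ 0 := by
    rw [← S.sqrt_eight_mul_eq]; exact (sub_pos.2 hg).ne'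
  have hval : S.admittedSweepingLoad g = (Real.sqrt 8)⁻¹ * (1 - S.kinematicRatio g)⁻¹ := by
    unfold admittedSweepingLoad kinematicRatio
    rw [S.sqrt_eight_mul_eq, one_sub_div (mul_ne_zero h8 hη), inv_div]
    field_simp
  rw [hval]
  exact hgeo

/-- The admitted load is positive inside the window. [folklore] -/
theorem admittedSweepingLoad_pos {g : ℝ} (hg : g < Real.sqrt (8 * S.eta)) :
    0 < S.admittedSweepingLoad g :=
  div_pos (Real.sqrt_pos.2 S.eta_pos) (sub_pos.2 hg)

/-- The admitted load increases with the growth factor `g` inside the window: faster forgetting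
(larger admitted amplification) burdens `shadow` more. [folklore] -/
theorem admittedSweepingLoad_mono {g g' : ℝ} (hgg' : g ≤ g') (hg' : g' < Real.sqrt (8 * S.eta)) :
    S.admittedSweepingLoad g ≤ S.admittedSweepingLoad g' := by
  unfold admittedSweepingLoad
  exact div_le_div_of_nonneg_left (Real.sqrt_nonneg _) (sub_pos.2 hg') (by linarith)

/-- Physical debris versus admitted debris at `g = 1`: `sweepingLoad = √((1-η)/η) · admittedSweepingLoad 1`
— the physical series weighs age `j` by the left-behind amplitude `√(1-η)` where the admitted one
weighs it by `√η` (in units of `jin/c₁`). [folklore] -/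
theorem sweepingLoad_eq_mul_admitted (hη : 1 / 8 < S.eta) :
    S.sweepingLoad = Real.sqrt (1 - S.eta) / Real.sqrt S.eta * S.admittedSweepingLoad 1 := by
  unfold sweepingLoad admittedSweepingLoad
  have hη0 : 0 < Real.sqrt S.eta := Real.sqrt_pos.2 S.eta_pos
  have hden : Real.sqrt (8 * S.eta) - 1 ≠ 0 := by linarith [S.one_lt_sqrt_eight_mul hη]
  field_simp

end CascadeSpecs

end Literature.Analysis.FluidPDE.FluidComputer

end
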